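import Literature.Probability.Percolation.QuadCrossingExplorationRegion
import HarnessLib

/-!
# Points below a barrier of the chart rectangle are below the wall `W = G(Γ) ∪ E`

Topic `Probability/Percolation`; chart-level proofs file towards the named fact
`SchrammSmirnov2011_lemma_6_1` (`QuadCrossingContinuity.lean`; O. Schramm, S. Smirnov, *On the
scaling limits of planar percolation*, Ann. Probab. 39 (2011), arXiv:1101.5820, proof of Lemma 6.1,
cases (2)–(3)).

`QuadCrossingExplorationRegion.lean` proves that the explored region of the lowest-crossing
exploration lies below the wall `W = G(Γ) ∪ E` of the big quad (`Charts.image_explored_subset_below`)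
— the argument never enters the strip `[Q] ∖ [Q']`: a `W`-avoiding path from the point is caught at
its first exit from `[Q']`, and the exit point is sent down the side of `R'` to `∂₁Q`.  The dual
exploration of case (3) needs the same conclusion for a different barrier: the chart preimage of a
LOW DUAL CROSSING (a compact preconnected `Γ ⊆ R'` joining the vertical sides whose right-side
points have height `≤ h`) and for the points joined to the bottom margin off `Γ` (`belowSet Γ`),
e.g. the chart preimages of the bottom open cluster.  `Charts.image_subset_below_of_mem_belowSet`
is that statement; its proof is the one of `Charts.image_explored_subset_below` with the
frontier-crossing facts replaced by explicit hypotheses.  Everything is proved.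

## References

* O. Schramm, S. Smirnov, Ann. Probab. 39 (2011) 1768–1814, arXiv:1101.5820, Lemma 6.1 and its
  proof. [SchrammSmirnov2011]
-/

noncomputable section

open Set Metric Filter Function
open _root_.Topology
open scoped unitInterval
open Literature.Probability.LatticeModels
open Literature.Topology.PlaneTopology

namespace Literature.Probability.Percolation

namespace SSContinuity

namespace Frame

variable (Φ : Frame) {D : Set ℂ} {Q Q' : QuadCrossing.Quad D}

variable {Φ} in
/-- **Points below a left–right barrier `Γ` of the chart rectangle are below `W = G(Γ) ∪ E` in
`[Q]`**: the argument of `Charts.image_explored_subset_below` for an ARBITRARY compact preconnected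
`Γ ⊆ R'` meeting both vertical sides, whose points on the right side have height `≤ h`, an exit set
`E` at height `h` (containing the right-side arc of heights `[m, h]`, with right-side contacts of
height `≥ m`, missing `∂₀Q'`), and a point `p ∈ R'` of `belowSet Γ` (joined to the bottom margin
off `Γ`).  Used with `Γ` the chart preimage of a low dual crossing in case (3).
[cite: SchrammSmirnov2011, proof of Lemma 6.1, cases (2)–(3)] -/
theorem Charts.image_subset_below_of_mem_belowSet (hΦ : Φ.Charts Q')
    (hcar : Q'.carrier ⊆ Q.carrier) (h0 : Q'.side 0 = Q.side 0) (h1 : Q'.side 1 ⊆ Q.side 1)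
    {Γ : Set ℂ} (hΓc : IsCompact Γ) (hΓpc : IsPreconnected Γ) (hΓr : Γ ⊆ Φ.rect)
    (hΓa : ∃ z ∈ Γ, z.re = Φ.a) (hΓb : ∃ z ∈ Γ, z.re = Φ.b) {h : ℝ}
    (hΓtop : ∀ z ∈ Γ, z.re = Φ.b → z.im ≤ h) {E : Set ℂ} (hEc : IsCompact E)
    (hEQ : E ⊆ Q.carrier) (hWpc : IsPreconnected (Φ.G '' Γ ∪ E)) (hE2 : (E ∩ Q.side 2).Nonempty)
    {m : ℝ} (hAE : Φ.G '' {u | u ∈ Φ.rect ∧ u.re = Φ.b ∧ u.im ∈ Icc m h} ⊆ E)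
    (hEm : ∀ u ∈ Φ.rect, u.re = Φ.b → Φ.G u ∈ E → m ≤ u.im) (hE0 : E ∩ Q'.side 0 = ∅)
    {p : ℂ} (hp : p ∈ Φ.belowSet Γ) (hprect : p ∈ Φ.rect) :
    Φ.G p ∈ {z | z ∈ Q.carrier ∧ ∀ t ∈ Q.side 3, ∀ π : Path z t,
      range π ⊆ Q.carrier → (range π ∩ (Φ.G '' Γ ∪ E)).Nonempty} := by
  have hLQ' : Φ.G '' Γ ⊆ Q'.carrier := by rw [hΦ.carrier]; exact image_mono hΓr
  have hLc : IsCompact (Φ.G '' Γ) := hΓc.image Φ.G.continuous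
  have hL0' : (Φ.G '' Γ ∩ Q'.side 0).Nonempty := by
    obtain ⟨z, hz, hzre⟩ := hΓa
    refine ⟨Φ.G z, ⟨z, hz, rfl⟩, ?_⟩
    rw [hΦ.side0]
    exact ⟨z, ⟨hΓr hz, hzre⟩, rfl⟩
  set W : Set ℂ := Φ.G '' Γ ∪ E with hW
  -- `W` is a compact connected subset of `[Q]` meeting `∂₀Q` and `∂₂Q`, so `∂₁Q` is below it
  have hWc : IsCompact W := hLc.union hEc
  have hWQ : W ⊆ Q.carrier := union_subset (hLQ'.trans hcar) hEQ
  have hW0 : (W ∩ Q.side 0).Nonempty := by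
    rw [← h0]; exact hL0'.mono (inter_subset_inter_left _ subset_union_left)
  have hW2 : (W ∩ Q.side 2).Nonempty := hE2.mono (inter_subset_inter_left _ subset_union_right)
  have hside1M := QuadCrossing.Quad.side_one_subset_below hWc hWpc hWQ hW0 hW2
  have hGpQ' : Φ.G p ∈ Q'.carrier := by rw [hΦ.carrier]; exact mem_image_of_mem _ hprect
  refine ⟨hcar hGpQ', fun t ht π hπ => ?_⟩
  by_contra hmiss
  have hπW : ∀ s, π s ∉ W := fun s h => hmiss ⟨π s, ⟨s, rfl⟩, h⟩
  -- the path as a map `ℝ → ℂ`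
  set f : ℝ → ℂ := fun s => π.extend s with hf
  have hfc : ContinuousOn f (Icc 0 1) := π.continuous_extend.continuousOn
  have hfW : ∀ s, f s ∉ W := fun s => hπW (projIcc 0 1 zero_le_one s)
  have hfQ : ∀ s, f s ∈ Q.carrier := fun s => hπ ⟨projIcc 0 1 zero_le_one s, rfl⟩
  have hf0 : f 0 = Φ.G p := π.extend_zero
  have hf1 : f 1 = t := π.extend_one
  -- the first exit from `[Q']`, or the endpoint: a time `s⋆` with `f([0, s⋆]) ⊆ [Q']` and
  -- `f s⋆ ∈ ∂[Q']`
  obtain ⟨sStar, hsI, hgood, hfront⟩ : ∃ s₁ ∈ Icc (0 : ℝ) 1, (∀ s ∈ Icc (0 : ℝ) s₁, f s ∈ Q'.carrier) ∧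
      f s₁ ∈ frontier Q'.carrier := by
    set B : Set ℝ := {s | s ∈ Icc (0 : ℝ) 1 ∧ f s ∉ Q'.carrier} with hB
    by_cases hBne : B.Nonempty
    · set s₁ : ℝ := sInf B with hs₁
      have hBbdd : BddBelow B := ⟨0, fun s hs => hs.1.1⟩
      have hs₁I : s₁ ∈ Icc (0 : ℝ) 1 :=
        ⟨le_csInf hBne fun s hs => hs.1.1, (csInf_le hBbdd hBne.some_mem).trans hBne.some_mem.1.2⟩
      have hlt_good : ∀ s ∈ Icc (0 : ℝ) 1, s < s₁ → f s ∈ Q'.carrier := fun s hs hlt => by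
        by_contra h
        exact absurd (csInf_le hBbdd ⟨hs, h⟩) (not_le.2 hlt)
      have hs₁good : f s₁ ∈ Q'.carrier := by
        rcases hs₁I.1.eq_or_lt with h | h
        · rw [← h, hf0]; exact hGpQ'
        · have hGc : IsClosed (Icc (0 : ℝ) 1 ∩ f ⁻¹' Q'.carrier) :=
            hfc.preimage_isClosed_of_isClosed isClosed_Icc Q'.isCompact_carrier.isClosed
          have hcl : s₁ ∈ closure (Ico (0 : ℝ) s₁) := by
            rw [closure_Ico h.ne]; exact ⟨h.le, le_rfl⟩
          have hsub : Ico (0 : ℝ) s₁ ⊆ Icc (0 : ℝ) 1 ∩ f ⁻¹' Q'.carrier := fun s hs =>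
            ⟨⟨hs.1, hs.2.le.trans hs₁I.2⟩, hlt_good s ⟨hs.1, hs.2.le.trans hs₁I.2⟩ hs.2⟩
          exact (hGc.closure_subset_iff.2 hsub hcl).2
      refine ⟨s₁, hs₁I, fun s hs => ?_, ?_⟩
      · rcases hs.2.eq_or_lt with h | h
        · rw [h]; exact hs₁good
        · exact hlt_good s ⟨hs.1, h.le.trans hs₁I.2⟩ h
      · by_contra hnf
        have hint : f s₁ ∈ interior Q'.carrier := by
          have : f s₁ ∈ closure Q'.carrier := subset_closure hs₁good
          rw [closure_eq_interior_union_frontier] at this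
          exact this.resolve_right hnf
        have hnb := hfc s₁ hs₁I (isOpen_interior.mem_nhds hint)
        obtain ⟨ε, hε, hball⟩ := Metric.mem_nhdsWithin_iff.1 hnb
        obtain ⟨s, hsB, hslt⟩ := exists_lt_of_csInf_lt hBne (show s₁ < s₁ + ε by linarith)
        have hs₁le : s₁ ≤ s := csInf_le hBbdd hsB
        have hsball : s ∈ ball s₁ ε ∩ Icc (0 : ℝ) 1 :=
          ⟨by rw [mem_ball, Real.dist_eq, abs_of_nonneg (by linarith)]; linarith, hsB.1⟩
        exact hsB.2 (interior_subset (hball hsball))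
    · rw [not_nonempty_iff_eq_empty] at hBne
      have hall : ∀ s ∈ Icc (0 : ℝ) 1, f s ∈ Q'.carrier := fun s hs => by
        by_contra h
        have : s ∈ B := ⟨hs, h⟩
        rw [hBne] at this
        exact this
      refine ⟨1, right_mem_Icc.2 zero_le_one, fun s hs => hall s ⟨hs.1, hs.2⟩, ?_⟩
      have h1Q' := hall 1 (right_mem_Icc.2 zero_le_one)
      rw [hf1] at h1Q' ⊢
      exact mem_frontier_of_mem_frontier_of_subset hcar h1Q' (Q.side_subset_frontier 3 ht)
  -- the exit point `e` and its chart preimage `ê`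
  set e : ℂ := f sStar with he
  have heQ' : e ∈ Q'.carrier := hgood sStar ⟨hsI.1, le_rfl⟩
  set ê : ℂ := Φ.G.symm e with hê'
  have hê : Φ.G ê = e := Φ.G.apply_symm_apply e
  have hpreim : ∀ {w : ℂ}, w ∈ Q'.carrier → Φ.G.symm w ∈ Φ.rect := by
    intro w hw
    rw [hΦ.carrier] at hw
    obtain ⟨u, hu, rfl⟩ := hw
    rwa [Φ.G.symm_apply_apply]
  have hêrect : ê ∈ Φ.rect := hpreim heQ'
  -- `ê ∈ belowSet Γ`: follow the path in the chart from `p` to `ê`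
  have hpbelow : p ∈ Φ.belowSet Γ := hp
  have hmul : ∀ s ∈ Icc (0 : ℝ) 1, s * sStar ∈ Icc (0 : ℝ) sStar := fun s hs =>
    ⟨mul_nonneg hs.1 hsI.1, by nlinarith [hs.2, hsI.1]⟩
  have hêbelow : ê ∈ Φ.belowSet Γ := by
    refine Φ.mem_belowSet_of_joinedIn hpbelow
      (JoinedIn.ofLine (f := fun s => Φ.G.symm (f (s * sStar))) ?_ ?_ ?_ ?_)
    · exact Φ.G.symm.continuous.comp_continuousOn (hfc.comp (by fun_prop) fun s hs =>
        ⟨(hmul s hs).1, (hmul s hs).2.trans hsI.2⟩)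
    · show Φ.G.symm (f (0 * sStar)) = p
      rw [zero_mul, hf0, Φ.G.symm_apply_apply]
    · show Φ.G.symm (f (1 * sStar)) = ê
      rw [one_mul]
    · rintro _ ⟨s, hs, rfl⟩
      have hsg : f (s * sStar) ∈ Q'.carrier := hgood _ (hmul s hs)
      refine ⟨Φ.rect_subset_extRect (hpreim hsg), fun hΓ' => hfW (s * sStar) ?_⟩
      exact Or.inl ⟨_, hΓ', Φ.G.apply_symm_apply _⟩
  have hêcl : ê ∈ closure (Φ.belowSet Γ) := subset_closure hêbelow
  have hêΓ : ê ∉ Γ := fun h => hfW sStar (Or.inl ⟨ê, h, hê⟩)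
  -- the tail joins `e` to `t ∈ ∂₃Q` off `W`, so `e` is not below `W`
  have heM : e ∉ {z | z ∈ Q.carrier ∧ ∀ t ∈ Q.side 3, ∀ π : Path z t,
      range π ⊆ Q.carrier → (range π ∩ W).Nonempty} := by
    obtain ⟨hgc, hg0, hg1, -⟩ := QuadCrossing.exists_reparam hfc hsI.1 hsI.2 le_rfl
    obtain ⟨q, hq⟩ := QuadCrossing.exists_path_of_continuousOn hgc
    have hq' : ∀ s : unitInterval, q s = f (sStar + (s : ℝ) * (1 - sStar)) := hq
    refine QuadCrossing.Quad.not_mem_below_of_path_avoiding ht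
      (q.cast hg0.symm (show t = (fun s : ℝ => f (sStar + s * (1 - sStar))) 1 by rw [hg1, hf1]))
      ?_ fun s => ?_
    · rintro _ ⟨s, rfl⟩
      simpa only [Path.cast_coe, hq'] using hfQ (sStar + s * (1 - sStar))
    · simpa only [Path.cast_coe, hq'] using hfW (sStar + s * (1 - sStar))
  -- conclusion from a `W`-avoiding path of `[Q]` from `e` to a point of `∂₁Q`
  have hfinish : ∀ z ∈ Q.side 1, ∀ q : Path e z, range q ⊆ Q.carrier → (∀ s, q s ∉ W) → False :=
    fun z hz q hq hqW => heM (QuadCrossing.Quad.mem_below_of_path (hside1M hz) (hcar heQ') q hq hqW)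
  -- points of a vertical segment of the side of `R'` down to the bottom corner
  have hcorner : ∀ r : ℝ, (⟨r, Φ.c⟩ : ℂ).im = Φ.c := fun r => rfl
  -- case analysis on the side of `e`
  have hef : e ∈ frontier Q'.carrier := hfront
  rw [QuadCrossing.Quad.frontier_carrier] at hef
  rcases hef with ((he0 | he1) | he2) | he3
  · -- left side: `re ê = a`; go down the left side to the corner `Q'(0,0) ∈ ∂₁Q`
    rw [hΦ.side0] at he0
    obtain ⟨u, ⟨hu, hure⟩, hue⟩ := he0
    have hêu : ê = u := by rw [hê', ← hue, Φ.G.symm_apply_apply]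
    have hêre : ê.re = Φ.a := by rw [hêu]; exact hure
    set k : ℂ := ⟨Φ.a, Φ.c⟩ with hk
    have hkrect : k ∈ Φ.rect := ⟨⟨le_rfl, Φ.hab.le⟩, ⟨le_rfl, Φ.hcd.le⟩⟩
    have hk1 : Φ.G k ∈ Q.side 1 := h1 (by rw [hΦ.side1]; exact ⟨k, ⟨hkrect, rfl⟩, rfl⟩)
    have hsegpts : ∀ w ∈ segment ℝ ê k, w ∈ Φ.rect ∧ w.re = Φ.a ∧ w.im ≤ ê.im := fun w hw => by
      obtain ⟨τ, hτ, hre, him⟩ := exists_of_mem_segment hw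
      have hwre : w.re = Φ.a := by rw [hre, hêre]; simp [hk]
      have hêc : Φ.c ≤ ê.im := hêrect.2.1
      have hkim : k.im = Φ.c := rfl
      rw [hkim] at him
      refine ⟨⟨show w.re ∈ Icc Φ.a Φ.b by rw [hwre]; exact ⟨le_rfl, Φ.hab.le⟩,
        show w.im ∈ Icc Φ.c Φ.d from ⟨by nlinarith [hτ.1, hτ.2], by nlinarith [hτ.1, hτ.2, hêrect.2.2]⟩⟩,
        hwre, by nlinarith [hτ.1, hτ.2]⟩
    have hsegW : ∀ w ∈ segment ℝ ê k, Φ.G w ∉ W := fun w hw => by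
      obtain ⟨hwrect, hwre, hwim⟩ := hsegpts w hw
      rintro (⟨z, hzΓ, hzw⟩ | hwE)
      · have hz : z = w := Φ.G.injective hzw
        rw [hz] at hzΓ
        have := Φ.im_lt_of_mem_closure_belowSet_left hΓc hΓpc hΓr hΓb hêcl hêΓ hêre hzΓ hwre
        linarith
      · have hw0 : Φ.G w ∈ Q'.side 0 := by rw [hΦ.side0]; exact ⟨w, ⟨hwrect, hwre⟩, rfl⟩
        have : Φ.G w ∈ E ∩ Q'.side 0 := ⟨hwE, hw0⟩
        rw [hE0] at this
        exact this
    refine hfinish _ hk1 (((segPath ê k).map Φ.G.continuous).cast hê.symm rfl) ?_ fun s => ?_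
    · rintro _ ⟨s, rfl⟩
      rw [Path.cast_coe]
      show Φ.G (segPath ê k s) ∈ Q.carrier
      refine hcar ?_
      rw [hΦ.carrier]
      exact mem_image_of_mem _ (hsegpts _ (range_segPath ê k ▸ mem_range_self s)).1
    · rw [Path.cast_coe]
      exact hsegW _ (range_segPath ê k ▸ mem_range_self s)
  · -- bottom side: `e ∈ ∂₁Q' ⊆ ∂₁Q`
    exact hfinish e (h1 he1) (Path.refl e) (by rintro _ ⟨s, rfl⟩; exact hcar heQ')
      fun s => by simpa using hfW sStar
  · -- right side: below the landing height, hence below `m`; go down to the corner `Q'(1,0)`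
    rw [hΦ.side2] at he2
    obtain ⟨u, ⟨hu, hure⟩, hue⟩ := he2
    have hêu : ê = u := by rw [hê', ← hue, Φ.G.symm_apply_apply]
    have hêre : ê.re = Φ.b := by rw [hêu]; exact hure
    have hêtop : ê.im ≤ h :=
      Φ.im_le_of_mem_closure_belowSet hΓc hΓpc hΓr hΓa hΓb hΓtop hêcl hêre
    have hêm : ê.im < m := by
      by_contra hge
      push Not at hge
      exact hfW sStar (Or.inr (hAE ⟨ê, ⟨hêrect, hêre, hge, hêtop⟩, hê⟩))
    set k : ℂ := ⟨Φ.b, Φ.c⟩ with hk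
    have hkrect : k ∈ Φ.rect := ⟨⟨Φ.hab.le, le_rfl⟩, ⟨le_rfl, Φ.hcd.le⟩⟩
    have hk1 : Φ.G k ∈ Q.side 1 := h1 (by rw [hΦ.side1]; exact ⟨k, ⟨hkrect, rfl⟩, rfl⟩)
    have hsegpts : ∀ w ∈ segment ℝ ê k, w ∈ Φ.rect ∧ w.re = Φ.b ∧ w.im ≤ ê.im := fun w hw => by
      obtain ⟨τ, hτ, hre, him⟩ := exists_of_mem_segment hw
      have hwre : w.re = Φ.b := by rw [hre, hêre]; simp [hk]
      have hêc : Φ.c ≤ ê.im := hêrect.2.1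
      have hkim : k.im = Φ.c := rfl
      rw [hkim] at him
      refine ⟨⟨show w.re ∈ Icc Φ.a Φ.b by rw [hwre]; exact ⟨Φ.hab.le, le_rfl⟩,
        show w.im ∈ Icc Φ.c Φ.d from ⟨by nlinarith [hτ.1, hτ.2], by nlinarith [hτ.1, hτ.2, hêrect.2.2]⟩⟩,
        hwre, by nlinarith [hτ.1, hτ.2]⟩
    have hsegW : ∀ w ∈ segment ℝ ê k, Φ.G w ∉ W := fun w hw => by
      obtain ⟨hwrect, hwre, hwim⟩ := hsegpts w hw
      rintro (⟨z, hzΓ, hzw⟩ | hwE)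
      · have hz : z = w := Φ.G.injective hzw
        rw [hz] at hzΓ
        have := Φ.im_lt_of_mem_closure_belowSet_right hΓc hΓpc hΓr hΓa hêcl hêΓ hêre hzΓ hwre
        linarith
      · have := hEm w hwrect hwre hwE
        linarith
    refine hfinish _ hk1 (((segPath ê k).map Φ.G.continuous).cast hê.symm rfl) ?_ fun s => ?_
    · rintro _ ⟨s, rfl⟩
      rw [Path.cast_coe]
      show Φ.G (segPath ê k s) ∈ Q.carrier
      refine hcar ?_
      rw [hΦ.carrier]
      exact mem_image_of_mem _ (hsegpts _ (range_segPath ê k ▸ mem_range_self s)).1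
    · rw [Path.cast_coe]
      exact hsegW _ (range_segPath ê k ▸ mem_range_self s)
  · -- top side: impossible below `Γ`
    rw [hΦ.side3] at he3
    obtain ⟨u, ⟨-, huim⟩, hue⟩ := he3
    have hêu : ê = u := by rw [hê', ← hue, Φ.G.symm_apply_apply]
    have hlt := Φ.im_lt_d_of_mem_belowSet hΓc hΓpc hΓr hΓa hΓb hêbelow
    rw [hêu, huim] at hlt
    exact lt_irrefl _ hlt


end Frame

end SSContinuity

end Literature.Probability.Percolation
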